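import Summits.Parity.GeneralizedHardyLittlewood.Theorems.FordMaynardSieveConst01651SieveConst01651CertValue
import Summits.Parity.GeneralizedHardyLittlewood.Theorems.FordMaynardSieveConst01651SieveConst01651BuchstabKernel
import Literature.NumberTheory.Sieve.FordMaynardSliceBlocks
import HarnessLib

/-!
# Route `FordMaynardSieveConst01651`, target `SieveConst01651` (stmt-Parity-19185), stub `stub_certValuePos` (R2):
# the certificate value in BUCHSTAB FORM — one function `Φ₆`, three one-dimensional pairings

Def-free helper file.  Starting from the kernel normal form `…CertValue.sieveBoundG1_coneCert_eq` (twelve integrals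
`∫ r!·S⁰_r(t)·F_{k−r}(1−t) dt` plus five constants `F_k(1)`), the kernels are convolution powers
(`…BuchstabKernel.kernel_eq_cpow`), the binomial weights collapse (`C(k,r)·r!/k! = 1/(k−r)!`), the double sum over
`(k, r)` is re-indexed by `(r, m = k − r)`, and the truncations are exact because `7ν₀ > 1`
(`S⁰_r(t) = 0` for `t ≤ rν₀`, `φ^{⋆m}(1−t) = 0` for `1 − t < mν₀`).  Result (`sieveBoundG1_coneCert_eq_buchstab`):

  `V(ν₀, coneCert) = Φ₆(1) + Σ_{r=1}^{3} ∫_{t ∈ (0,1]} S⁰_r(t) · Φ₆(1 − t) dt`,  `Φ₆ = Σ_{m=1}^{6} φ_{ν₀}^{⋆m}/m!`,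

where `Φ₆` solves Buchstab's Volterra equation (`…BuchstabKernel.buchstab_volterra_six`) — the form a monotone integer
recursion can certify.  Also: the ordered slice functions `S⁰_r` of cone data are measurable and locally bounded
(`measurable_sliceFnOrd`, `locBdd_sliceFnOrd`), and `kernel_eq_cpow'` (all `s`).

References: [FordMaynard2024PrimeSieves] arXiv:2407.14368, Theorem 7.3 (a), §8.2.
-/

noncomputable section

open MeasureTheory Set Finset
open scoped Classical
open Literature.NumberTheory.Sieve Literature.NumberTheory.Sieve.FordMaynard
open Literature.Analysis.Convolution

namespace Summit.Parity.GeneralizedHardyLittlewood.FordMaynardSieveConst01651SieveConst01651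

/-! ### Kernels as convolution powers, all arguments -/

/-- **`F_m(s) = φ_ν^{⋆m}(s)` for every `s`** (`m ≥ 1`, `ν > 0`): both sides vanish for `s ≤ 0`. [folklore] -/
theorem kernel_eq_cpow' {ν : ℝ} (hν : 0 < ν) {m : ℕ} (hm : 1 ≤ m) (s : ℝ) :
    sliceIntegral m s (fun u => if ∀ i, ν < u i then 1 / ∏ i, u i else 0) =
      cpow (fun t : ℝ => if ν < t then 1 / t else 0) m s := by
  by_cases hs : 0 < s
  · exact kernel_eq_cpow hν hm hs
  · rw [sliceIntegral_eq_zero_of_nonpos m (not_lt.1 hs),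
      cpow_eq_zero_of_lt (η := ν) (fun t ht => boxMu_of_le ht.le) hm]
    have h1 : (1 : ℝ) * ν ≤ m * ν := mul_le_mul_of_nonneg_right (by exact_mod_cast hm) hν.le
    linarith [not_lt.1 hs]

/-- Local boundedness is stable under `t ↦ f(1 − t)`. [folklore] -/
theorem locBdd_comp_one_sub {f : ℝ → ℝ} (hf : LocBdd f) : LocBdd (fun t => f (1 - t)) := by
  refine ⟨hf.measurable.comp (measurable_const.sub measurable_id), fun A => ?_⟩
  obtain ⟨C, hC⟩ := hf.bdd (1 + A)
  refine ⟨C, fun t ht => hC _ ?_⟩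
  have h1 : |1 - t| ≤ |(1 : ℝ)| + |t| := abs_sub _ _
  rw [abs_one] at h1
  linarith

/-! ### The ordered slice functions of cone data: measurable and locally bounded -/

/-- **`t ↦ S⁰_r(t)` is measurable** for cone data `g₀` piecewise constant on the ordered cone (`ν > 0`): by
`sliceFn_symmExt_eq_ordered` it is `1/r!` times a parametric slice integral of a bounded measurable integrand.
[cite: FordMaynard2024PrimeSieves, Definition 7.2 (sub-class), §4.2] -/
theorem measurable_sliceFnOrd {g₀ : VecFn} (hpc : IsPiecewiseConstOnCone g₀) {ν : ℝ} (hν : 0 < ν) (r : ℕ) :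
    Measurable (fun t : ℝ => sliceIntegral r t
      (fun v => if (∀ i, ν < v i) ∧ Monotone v then g₀ r v / ∏ i, v i else 0)) := by
  have hs := isSymmetric_symmExt' g₀
  have hpc' := isPiecewiseConstOnCone_symmExt' hpc
  have hGm : Measurable
      (fun v : Fin r → ℝ => if ∀ i, ν < v i then g₀ r (v ∘ ⇑(Tuple.sort v)) / ∏ i, v i else 0) :=
    measurable_boxIntegrand ν (measurable_apply_of_cone hs hpc' r)
  have hmeas : Measurable (fun t : ℝ => sliceIntegral r t
      (fun v : Fin r → ℝ => if ∀ i, ν < v i then g₀ r (v ∘ ⇑(Tuple.sort v)) / ∏ i, v i else 0)) :=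
    measurable_sliceIntegral_param r measurable_id (hGm.comp measurable_snd)
  have heq : (fun t : ℝ => sliceIntegral r t
      (fun v => if (∀ i, ν < v i) ∧ Monotone v then g₀ r v / ∏ i, v i else 0)) =
      fun t => (1 / (r.factorial : ℝ)) * sliceIntegral r t
        (fun v : Fin r → ℝ => if ∀ i, ν < v i then g₀ r (v ∘ ⇑(Tuple.sort v)) / ∏ i, v i else 0) := by
    funext t
    rw [sliceFn_symmExt_eq_ordered hpc hν r t]
    have : (r.factorial : ℝ) ≠ 0 := by positivity
    field_simp
  rw [heq]
  exact hmeas.const_mul _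

/-- **`t ↦ S⁰_r(t)` is locally bounded** (and measurable) for cone data (`ν > 0`).
[cite: FordMaynard2024PrimeSieves, §8.2 (the bound for |I₅'|)] -/
theorem locBdd_sliceFnOrd {g₀ : VecFn} (hpc : IsPiecewiseConstOnCone g₀) {ν : ℝ} (hν : 0 < ν) (r : ℕ) :
    LocBdd (fun t : ℝ => sliceIntegral r t
      (fun v => if (∀ i, ν < v i) ∧ Monotone v then g₀ r v / ∏ i, v i else 0)) := by
  refine ⟨measurable_sliceFnOrd hpc hν r, fun A => ?_⟩
  have hs := isSymmetric_symmExt' g₀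
  have hpc' := isPiecewiseConstOnCone_symmExt' hpc
  obtain ⟨C, hC0, hC⟩ := exists_abs_apply_le_of_cone hs hpc' r
  cases r with
  | zero => exact ⟨0, fun t _ => by simp [sliceIntegral]⟩
  | succ d =>
    refine ⟨1 / ((d + 1).factorial : ℝ) * (C / ν ^ (d + 1) * |A| ^ d), fun t ht => ?_⟩
    rw [show sliceIntegral (d + 1) t
        (fun v => if (∀ i, ν < v i) ∧ Monotone v then g₀ (d + 1) v / ∏ i, v i else 0) =
        (1 / ((d + 1).factorial : ℝ)) * sliceIntegral (d + 1) t
          (fun v : Fin (d + 1) → ℝ => if ∀ i, ν < v i then g₀ (d + 1) (v ∘ ⇑(Tuple.sort v)) / ∏ i, v i else 0)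
        from by
          rw [sliceFn_symmExt_eq_ordered hpc hν (d + 1) t]
          have : ((d + 1).factorial : ℝ) ≠ 0 := by positivity
          field_simp]
    rw [abs_mul, abs_of_pos (by positivity : (0 : ℝ) < 1 / ((d + 1).factorial : ℝ))]
    refine mul_le_mul_of_nonneg_left ?_ (by positivity)
    by_cases ht0 : 0 ≤ t
    · have hb := abs_sliceIntegral_le d ht0 (by positivity : (0 : ℝ) ≤ C / ν ^ (d + 1))
        (G := fun v : Fin (d + 1) → ℝ => if ∀ i, ν < v i then g₀ (d + 1) (v ∘ ⇑(Tuple.sort v)) / ∏ i, v i else 0)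
        (fun v _ _ => abs_boxIntegrand_le hν hC0 (fun x => hC x) v)
      refine hb.trans (mul_le_mul_of_nonneg_left ?_ (by positivity))
      exact pow_le_pow_left₀ ht0 ((le_abs_self t).trans (ht.trans (le_abs_self A))) d
    · rw [sliceIntegral_eq_zero_of_nonpos (d + 1) (not_le.1 ht0).le, abs_zero]
      positivity

/-! ### The Buchstab form of the certificate value -/

/-- The `k = 1` term of `Φ₆(1)`: `φ_{ν₀}(1) = 1`. [folklore] -/
theorem cpow_one_boxMu_at_one :
    cpow (fun t : ℝ => if (1651 / 10000 : ℝ) < t then 1 / t else 0) 1 1 = 1 := by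
  rw [cpow_one]; norm_num

/-- Exact truncation: for `r ∈ {1,2,3}`, `m ≥ 7 − r` and every `t`, `S⁰_r(t) · φ^{⋆m}(1 − t) = 0` at
`ν₀ = 0.1651` — either `t ≤ rν₀` (`S⁰_r(t) = 0`) or `1 − t < 1 − rν₀ < mν₀` (`7ν₀ > 1`). [folklore] -/
theorem sliceFnOrd_mul_cpow_eq_zero (g₀ : VecFn) {r m : ℕ} (hr : 1 ≤ r) (hm : 7 ≤ r + m) (t : ℝ) :
    sliceIntegral r t (fun v => if (∀ i, (1651 / 10000 : ℝ) < v i) ∧ Monotone v then g₀ r v / ∏ i, v i else 0) *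
      cpow (fun t : ℝ => if (1651 / 10000 : ℝ) < t then 1 / t else 0) m (1 - t) = 0 := by
  by_cases ht : t ≤ r * (1651 / 10000 : ℝ)
  · rw [sliceFnOrd_eq_zero_of_le g₀ hr ht, zero_mul]
  · rcases Nat.eq_zero_or_pos m with rfl | hm1
    · simp [cpow_zero]
    · rw [cpow_eq_zero_of_lt (η := (1651 / 10000 : ℝ)) (fun s hs => boxMu_of_le hs.le) hm1 ?_, mul_zero]
      have h7 : (7 : ℝ) ≤ (r : ℝ) + (m : ℝ) := by exact_mod_cast hm
      push Not at ht
      nlinarith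

/-- **The certificate value in Buchstab form.**  With `ν₀ = 1651/10000`, `φ = 𝟙[· > ν₀]/·`,
`Φ₆ = Σ_{m=1}^{6} φ^{⋆m}/m!` and the ordered slice functions `S⁰_r` of the witness `coneCert`:

  `sieveBoundG1 ν₀ coneCert = Φ₆(1) + Σ_{r=1}^{3} ∫_{t ∈ (0,1]} S⁰_r(t) · Φ₆(1 − t) dt`.

[cite: FordMaynard2024PrimeSieves, Theorem 7.3 (a), §8.2] -/
theorem sieveBoundG1_coneCert_eq_buchstab :
    sieveBoundG1 (1651 / 10000) coneCert =
      (∑ m ∈ Finset.Icc 1 6, (1 / (m.factorial : ℝ)) *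
          cpow (fun t : ℝ => if (1651 / 10000 : ℝ) < t then 1 / t else 0) m 1) +
        ∑ r ∈ Finset.Icc 1 3, ∫ t in Set.Ioc 0 1,
          sliceIntegral r t
              (fun v => if (∀ i, (1651 / 10000 : ℝ) < v i) ∧ Monotone v then coneCert r v / ∏ i, v i else 0) *
            ∑ m ∈ Finset.Icc 1 6, (1 / (m.factorial : ℝ)) *
              cpow (fun t : ℝ => if (1651 / 10000 : ℝ) < t then 1 / t else 0) m (1 - t) := by
  have hν : (0 : ℝ) < 1651 / 10000 := by norm_num
  set φ : ℝ → ℝ := fun t => if (1651 / 10000 : ℝ) < t then 1 / t else 0 with hφ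
  set S : ℕ → ℝ → ℝ := fun r t => sliceIntegral r t
    (fun v => if (∀ i, (1651 / 10000 : ℝ) < v i) ∧ Monotone v then coneCert r v / ∏ i, v i else 0) with hS
  have hSb : ∀ r, LocBdd (S r) := fun r => locBdd_sliceFnOrd isPiecewiseConstOnCone_coneCert hν r
  have hφb : LocBdd φ := locBdd_boxMu hν
  -- integrability of the pairings on `(0,1]`
  have hInt : ∀ r m : ℕ, IntegrableOn (fun t => S r t * ((1 / (m.factorial : ℝ)) * cpow φ m (1 - t)))
      (Set.Ioc 0 1) := fun r m =>
    ((hSb r).mul (locBdd_comp_one_sub ((hφb.cpow m).const_mul _))).integrableOn_Ioc 0 1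
  rw [sieveBoundG1_coneCert_eq]
  -- Step 1: kernels are convolution powers
  have hK : ∀ m : ℕ, 1 ≤ m → ∀ s : ℝ,
      sliceIntegral m s (fun u => if ∀ i, (1651 / 10000 : ℝ) < u i then 1 / ∏ i, u i else 0) = cpow φ m s :=
    fun m hm s => kernel_eq_cpow' hν hm s
  have hstep1 : ∀ k ∈ Finset.Icc 2 6,
      (1 / (k.factorial : ℝ)) *
        (sliceIntegral k 1 (fun u => if ∀ i, (1651 / 10000 : ℝ) < u i then 1 / ∏ i, u i else 0) +
          ∑ r ∈ Finset.Ico 1 (min k 4), (k.choose r : ℝ) * ∫ t in Set.Ioc 0 1,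
            ((r.factorial : ℝ) * S r t) *
              sliceIntegral (k - r) (1 - t) (fun u => if ∀ i, (1651 / 10000 : ℝ) < u i then 1 / ∏ i, u i else 0)) =
      (1 / (k.factorial : ℝ)) * cpow φ k 1 +
        ∑ r ∈ Finset.Ico 1 (min k 4), ∫ t in Set.Ioc 0 1,
          S r t * ((1 / ((k - r).factorial : ℝ)) * cpow φ (k - r) (1 - t)) := by
    intro k hk
    rw [Finset.mem_Icc] at hk
    rw [hK k (by omega) 1, mul_add, Finset.mul_sum]
    congr 1
    refine Finset.sum_congr rfl fun r hr => ?_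
    rw [Finset.mem_Ico] at hr
    have hrk : r ≤ k := by omega
    rw [← integral_const_mul, ← integral_const_mul]
    refine setIntegral_congr_fun measurableSet_Ioc fun t _ => ?_
    rw [hK (k - r) (by omega) (1 - t)]
    -- coefficients: (1/k!)·C(k,r)·r! = 1/(k−r)!
    have hcoef : (1 / (k.factorial : ℝ)) * ((k.choose r : ℝ) * (r.factorial : ℝ)) =
        1 / ((k - r).factorial : ℝ) := by
      have h := Nat.choose_mul_factorial_mul_factorial hrk
      have h' : (k.choose r : ℝ) * (r.factorial : ℝ) * ((k - r).factorial : ℝ) = (k.factorial : ℝ) := by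
        exact_mod_cast h
      have hk0 : (k.factorial : ℝ) ≠ 0 := by positivity
      have hkr0 : ((k - r).factorial : ℝ) ≠ 0 := by positivity
      field_simp
      linarith [h']
    calc (1 / (k.factorial : ℝ)) * ((k.choose r : ℝ) * (((r.factorial : ℝ) * S r t) * cpow φ (k - r) (1 - t)))
        = ((1 / (k.factorial : ℝ)) * ((k.choose r : ℝ) * (r.factorial : ℝ))) * (S r t * cpow φ (k - r) (1 - t)) := by
          ring
      _ = S r t * ((1 / ((k - r).factorial : ℝ)) * cpow φ (k - r) (1 - t)) := by rw [hcoef]; ring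
  rw [Finset.sum_congr rfl hstep1, Finset.sum_add_distrib, ← add_assoc]
  -- Step 2: the constant part is `Φ₆(1)`
  have hconst : (1 : ℝ) + ∑ k ∈ Finset.Icc 2 6, (1 / (k.factorial : ℝ)) * cpow φ k 1 =
      ∑ m ∈ Finset.Icc 1 6, (1 / (m.factorial : ℝ)) * cpow φ m 1 := by
    have h1 : Finset.Icc 1 6 = insert 1 (Finset.Icc 2 6) := by
      ext m; simp only [Finset.mem_Icc, Finset.mem_insert]; omega
    rw [h1, Finset.sum_insert (by simp), hφ, cpow_one_boxMu_at_one]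
    simp
  rw [hconst]
  congr 1
  -- Step 3: exchange the order of summation `(k, r) ↦ (r, k)`
  have hcomm : ∑ k ∈ Finset.Icc 2 6, ∑ r ∈ Finset.Ico 1 (min k 4), ∫ t in Set.Ioc 0 1,
        S r t * ((1 / ((k - r).factorial : ℝ)) * cpow φ (k - r) (1 - t)) =
      ∑ r ∈ Finset.Icc 1 3, ∑ k ∈ Finset.Icc (r + 1) 6, ∫ t in Set.Ioc 0 1,
        S r t * ((1 / ((k - r).factorial : ℝ)) * cpow φ (k - r) (1 - t)) :=
    Finset.sum_comm' (fun k r => by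
      simp only [Finset.mem_Icc, Finset.mem_Ico]
      omega)
  rw [hcomm]
  refine Finset.sum_congr rfl fun r hr => ?_
  rw [Finset.mem_Icc] at hr
  -- Step 4: re-index `k = m + r`
  have hreindex : ∑ k ∈ Finset.Icc (r + 1) 6, ∫ t in Set.Ioc 0 1,
        S r t * ((1 / ((k - r).factorial : ℝ)) * cpow φ (k - r) (1 - t)) =
      ∑ m ∈ Finset.Icc 1 (6 - r), ∫ t in Set.Ioc 0 1,
        S r t * ((1 / (m.factorial : ℝ)) * cpow φ m (1 - t)) := by
    have hmap : Finset.Icc (r + 1) 6 = (Finset.Icc 1 (6 - r)).map (addRightEmbedding r) := by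
      rw [Finset.map_add_right_Icc]
      congr 1 <;> omega
    rw [hmap, Finset.sum_map]
    refine Finset.sum_congr rfl fun m _ => ?_
    simp only [addRightEmbedding_apply, Nat.add_sub_cancel]
  rw [hreindex]
  -- Step 5: extend `m` to `1..6` (the added terms vanish identically) and swap `∫` and `Σ`
  have hextend : ∑ m ∈ Finset.Icc 1 (6 - r), ∫ t in Set.Ioc 0 1,
        S r t * ((1 / (m.factorial : ℝ)) * cpow φ m (1 - t)) =
      ∑ m ∈ Finset.Icc 1 6, ∫ t in Set.Ioc 0 1, S r t * ((1 / (m.factorial : ℝ)) * cpow φ m (1 - t)) := by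
    refine Finset.sum_subset (fun m hm => ?_) (fun m hm hm' => ?_)
    · rw [Finset.mem_Icc] at hm ⊢; omega
    · rw [Finset.mem_Icc] at hm hm'
      refine setIntegral_eq_zero_of_forall_eq_zero fun t _ => ?_
      have hz := sliceFnOrd_mul_cpow_eq_zero coneCert (r := r) (m := m) hr.1 (by omega) t
      calc S r t * ((1 / (m.factorial : ℝ)) * cpow φ m (1 - t))
          = (1 / (m.factorial : ℝ)) * (S r t * cpow φ m (1 - t)) := by ring
        _ = 0 := by rw [hS, hφ, hz, mul_zero]
  rw [hextend, ← integral_finsetSum _ (fun m _ => hInt r m)]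
  refine setIntegral_congr_fun measurableSet_Ioc fun t _ => ?_
  rw [Finset.mul_sum]

end Summit.Parity.GeneralizedHardyLittlewood.FordMaynardSieveConst01651SieveConst01651

end
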